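import Summits.RiemannHypothesis.RiemannHypothesis.Theorems.PfPersistenceCoefficientRigiditySymbol
import HarnessLib

/-!
# Coefficient rigidity of window positivity, VIII-c: shielding by an origin atom — the sharp
compensation threshold for prime deletion
(pub-rhpf cand-7, gen 9; mechanism/rigidity campaign; no RH claims)

A consequence of the symbol criterion (part VIII-b).  A defect at a site `x₁ ≠ 0` (width zero:
it alone destroys positivity, parts III-b/VI) can be SHIELDED by an atom at the origin, and the
threshold is sharp:

* `originPair_nonneg_iff` — for `x₁ ≠ 0`:
  `(∀ g test, 0 ≤ Re (W(g ⋆ g̃) + 2c₀ (g ⋆ g̃)(0) + c₁((g ⋆ g̃)(x₁) + (g ⋆ g̃)(-x₁))))`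
  `↔ RiemannHypothesis ∧ |c₁| ≤ c₀`.
* `compensatedDeletion_positivity_iff` — **tables**: delete the prime `p` from `ζ`'s table and
  put weight `-m` at `n = 1` (an atom `+2m δ₀` on the explicit-formula measure, since table
  weights are subtracted).  Then
  `Positivity ↔ RiemannHypothesis ∧ log p/√p ≤ m`:
  the deleted Chebyshev mass `Λ(p)/√p` is exactly the price of restoring positivity.
* `compensatedDeletion_not_positivity` — **(RH-free)** below the threshold, `m < log p/√p`,
  positivity fails unconditionally; `compensatedDeletion_positivity_of_riemannHypothesis` — at or
  above it, positivity holds under RH.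

(Why this matters for the campaign: "prime deletion is detected by window positivity" is a
statement about the table with the ORIGIN ENTRY FIXED; the detection is exactly as strong as the
deleted mass, and an origin atom of that mass hides it.  RH is NOT claimed.)  ALL STATEMENTS ARE
PROVED (no `sorry`, no new axioms, RH only as an explicit hypothesis or conjunct); no sentence is
DATA.

References: E. Bombieri, Rend. Lincei (9) 11 (2000) 183–233, Thm. 1; A. Weil (1952).
-/

set_option linter.dupNamespace false

noncomputable section

open Complex Filter Set MeasureTheory
open scoped Real Topology ComplexConjugate NNReal

namespace Summit.RiemannHypothesis.RiemannHypothesis.Theorems.PfPersistenceCoefficientRigidity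

open Literature.NumberTheory.LFunctions
open Literature.NumberTheory.LFunctions.WeilConverse
open Summit.RiemannHypothesis.RiemannHypothesis.Theorems.PfPersistenceDownCone
open Summit.RiemannHypothesis.RiemannHypothesis.Theorems.PfPersistenceBarrier

/-! ## §45 The symbol of an origin atom plus one site -/

/-- `c₀ + c₁ cos(t x₁) ≥ 0` for all `t` iff `|c₁| ≤ c₀` (`x₁ ≠ 0`). [this work] -/
theorem forall_add_mul_cos_nonneg_iff {x₁ : ℝ} (hx₁ : x₁ ≠ 0) (c₀ c₁ : ℝ) :
    (∀ t : ℝ, 0 ≤ c₀ + c₁ * Real.cos (t * x₁)) ↔ |c₁| ≤ c₀ := by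
  constructor
  · intro h
    obtain ⟨θ₀, hθ₀⟩ := exists_mul_cos_eq_neg_abs hx₁ c₁
    have := h θ₀
    rw [hθ₀] at this
    linarith
  · intro h t
    have h1 : -|c₁| ≤ c₁ * Real.cos (t * x₁) := by
      rw [neg_le]
      calc -(c₁ * Real.cos (t * x₁)) = (-c₁) * Real.cos (t * x₁) := by ring
        _ ≤ |(-c₁) * Real.cos (t * x₁)| := le_abs_self _
        _ = |c₁| * |Real.cos (t * x₁)| := by rw [abs_mul, abs_neg]
        _ ≤ |c₁| := mul_le_of_le_one_right (abs_nonneg _) (Real.abs_cos_le_one _)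
    linarith

/-- **Origin atom plus one site** (sites indexed by themselves, `E = {0, x₁}`, `x₁ ≠ 0`):
`W + c(0)·(2δ₀) + c(x₁)(δ_{x₁} + δ_{-x₁})` is positive on the test class iff RH and
`|c(x₁)| ≤ c(0)`. [this work] -/
theorem originPair_nonneg_iff {x₁ : ℝ} (hx₁ : x₁ ≠ 0) (c : ℝ → ℝ) :
    (∀ g : ℝ → ℂ, IsWeilTest g → 0 ≤ (multiSiteQuadratic ({0, x₁} : Finset ℝ) c id g).re) ↔
      RiemannHypothesis ∧ |c x₁| ≤ c 0 := by
  rw [multiSiteQuadratic_nonneg_iff_symbol, ← forall_add_mul_cos_nonneg_iff hx₁]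
  have e : ∀ t, siteSymbol ({0, x₁} : Finset ℝ) c id t = c 0 + c x₁ * Real.cos (t * x₁) := by
    intro t
    rw [siteSymbol, Finset.sum_pair (Ne.symm hx₁)]
    simp
  simp_rw [e]

/-! ## §46 Tables: deleting a prime and compensating at the origin -/

/-- `ζ`'s table with the prime `p` DELETED and weight `-m` put at `n = 1` (position `log 1 = 0`;
table weights are subtracted in the explicit formula, so this ADDS the atom `2m δ₀`).
[this work] -/
def compensatedDeletion (p : ℕ) (m : ℝ) : ℕ → ℝ := fun n ↦
  if n = p then 0 else if n = 1 then -m else zetaTable n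

/-- Off `{1, p}` the compensated table is `ζ`'s. [this work] -/
theorem compensatedDeletion_eq_of_not_mem {p : ℕ} {m : ℝ} {n : ℕ}
    (hn : n ∉ ({1, p} : Finset ℕ)) : compensatedDeletion p m n = zetaTable n := by
  rw [Finset.mem_insert, Finset.mem_singleton, not_or] at hn
  simp [compensatedDeletion, hn.1, hn.2]

/-- `ζ`'s table at a prime: `Λ(p)/√p = log p/√p`. [folklore] -/
theorem zetaTable_prime {p : ℕ} (hp : p.Prime) : zetaTable p = Real.log p / Real.sqrt p := by
  simp [zetaTable, ArithmeticFunction.vonMangoldt_apply_prime hp]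

/-- `ζ`'s table at `1` vanishes. [folklore] -/
theorem zetaTable_one : zetaTable 1 = 0 := by
  simp [zetaTable]

/-- The symbol of the compensated deletion: `P(t) = m + (log p/√p) cos(t log p)`. [this work] -/
theorem siteSymbol_compensatedDeletion {p : ℕ} (hp : p.Prime) (m t : ℝ) :
    siteSymbol ({1, p} : Finset ℕ) (fun n ↦ zetaTable n - compensatedDeletion p m n)
      (fun n : ℕ ↦ Real.log (n : ℝ)) t =
        m + Real.log p / Real.sqrt p * Real.cos (t * Real.log p) := by
  have h1p : (1 : ℕ) ≠ p := fun h ↦ hp.one_lt.ne' h.symm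
  rw [siteSymbol, Finset.sum_pair h1p]
  simp [compensatedDeletion, h1p, zetaTable_one, zetaTable_prime hp]

/-- **The sharp compensation threshold.**  For a prime `p` and `m ∈ ℝ`:
`Positivity (tableDatum (compensatedDeletion p m)) ↔ RiemannHypothesis ∧ log p/√p ≤ m`.
(RH is NOT claimed; it is a conjunct.) [this work] -/
theorem compensatedDeletion_positivity_iff {p : ℕ} (hp : p.Prime) (m : ℝ) :
    (tableDatum (compensatedDeletion p m)).Positivity ↔
      RiemannHypothesis ∧ Real.log p / Real.sqrt p ≤ m := by
  have hlog : Real.log (p : ℝ) ≠ 0 :=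
    (Real.log_pos (by exact_mod_cast hp.one_lt)).ne'
  rw [finiteEdit_positivity_iff_symbol (E := ({1, p} : Finset ℕ))
    (fun n hn ↦ compensatedDeletion_eq_of_not_mem hn)]
  simp_rw [siteSymbol_compensatedDeletion hp]
  rw [forall_add_mul_cos_nonneg_iff hlog,
    abs_of_nonneg (div_nonneg (Real.log_natCast_nonneg p) (Real.sqrt_nonneg _))]

/-- **(RH-free)** Below the threshold the compensated deletion is NOT positive: for
`m < log p/√p` some test function has `Re Q < 0`, unconditionally. [this work] -/
theorem compensatedDeletion_not_positivity {p : ℕ} (hp : p.Prime) {m : ℝ}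
    (hm : m < Real.log p / Real.sqrt p) :
    ¬ (tableDatum (compensatedDeletion p m)).Positivity := fun h ↦
  not_le.2 hm ((compensatedDeletion_positivity_iff hp m).1 h).2

/-- Under RH, at or above the threshold the compensated deletion IS positive: the origin atom of
mass `m ≥ log p/√p` shields the deleted prime. [this work] -/
theorem compensatedDeletion_positivity_of_riemannHypothesis (hRH : RiemannHypothesis) {p : ℕ}
    (hp : p.Prime) {m : ℝ} (hm : Real.log p / Real.sqrt p ≤ m) :
    (tableDatum (compensatedDeletion p m)).Positivity :=
  (compensatedDeletion_positivity_iff hp m).2 ⟨hRH, hm⟩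

/-- Pure deletion (`m = 0`) is never positive — recovering part III-b's deletion theorem for a
single prime from the threshold (`0 < log p/√p`). [this work] -/
theorem compensatedDeletion_zero_not_positivity {p : ℕ} (hp : p.Prime) :
    ¬ (tableDatum (compensatedDeletion p 0)).Positivity :=
  compensatedDeletion_not_positivity hp
    (div_pos (Real.log_pos (by exact_mod_cast hp.one_lt))
      (Real.sqrt_pos.2 (by exact_mod_cast hp.pos)))

end Summit.RiemannHypothesis.RiemannHypothesis.Theorems.PfPersistenceCoefficientRigidity

end
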